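import Summits.QuantumFields.YangMills.Theorems.UnitScaleTiltProp7GaugeTwistLogRatio
import Summits.QuantumFields.YangMills.Theorems.UnitScaleTiltProp7CovariantPlaquetteExpansion
import HarnessLib

/-!
# Route `UnitScaleTilt`, crux K1 «MinimiserStabilityRegPr» (stmt-QuantumFields-19200), route-R E′ path (α′), row (P-bch):
# THE CHART OF A PINNED RE-GAUGING TO FIRST ORDER —
# `log((X^u)_b·W_b*) = log(X_b·W_b*) + (μ(b₋) − W_b·μ(b₊)·W_b*) + R₂`, `μ := log ∘ u`, with `R₂` a sum of PRODUCTS OF TWO SMALL QUANTITIES: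
# `‖R₂‖ ≤ 2‖u(b₋) − 1‖·‖log(X_bW_b*)‖ + 3‖μ(b₋)‖·‖μ(b₋) − W_bμ(b₊)W_b*‖ + 4‖log(X_bW_b*)‖·‖μ(b₋) − W_bμ(b₊)W_b*‖`

Cell `ym3-torus`, width seat `ym3-torus-px15` (gen 0); row (P-bch) named by ★p1 g14 (2026-08-28 17:25Z, «NEXT-CYCLE PENS»).  THEOREMS ONLY (0 `def`, 0 `sorry`);
`--supports stmt-QuantumFields-19200`, count-neutral.  YM₃ on T³ is a ladder rung (R3), not the Clay problem; nothing here claims a stub, the crux, d = 4 or the mass gap.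

WHY.  The path-(α) door with mass slack ✓ `Prop7LocMinOfPinnedChartSlice.stub_PV3E_of_pinnedChartSliceM` takes, per competitor `W′`, ONE pinned gauge `g` and the
Hermitian chart `D = −i·log((W′^g)_b·W_b⁻¹)`.  The inhabitant of record (α′) builds `g = u·g‴` from the untwisting gauge `g‴` (✓ `Prop7UntwistChartOfTwist`, chart `D‴`) and
a pinned corrector `u = e^{−ψ}` solving the LINEARISED centre-harmonic (S_H) condition; the door however sees the EXACT chart of `W′^{u·g‴} = (W′^{g‴})^u`.  This file is the
matrix analysis of that last step: the exact chart of a re-gauged configuration `X^u` against the background `W` equals the chart of `X` plus the coarse pure gauge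
`μ(b₋) − W_bμ(b₊)W_b*` of `μ = log u`, up to a remainder `R₂` every term of which is a product of two of the small quantities {`‖u − 1‖`, `‖log(X_bW_b*)‖`,
`‖μ(b₋) − W_bμ(b₊)W_b*‖`} — so that in the door's currency (`‖log(X_bW_b*)‖ ≤ s‴ℓ⁻¹`, covariant difference of `μ` `≲ s_Qℓ⁻¹`, `‖u − 1‖ ≲ s_Q`) the remainder is
`O(s_Q(s‴ + s_Q)ℓ⁻¹)`, as the namer books it («`‖R₂ b‖ ≤ C·sQ²ℓ⁻¹`»), and NOT the naive three-factor BCH size `O(s_Q²)`.  The one analytic input is [Balaban1985Averaging] (31)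
(✓ `B7Eq31BCH.eq31_of_sum_le`, `‖log(eˣe^Y) − X − Y‖ ≤ 2‖X‖‖Y‖`), used three times; the refinement `‖log(eˣ·e^{−X+δ}) − δ‖ ≤ 3‖X‖‖δ‖` (the remainder vanishes at `δ = 0`:
conjugation is exact) is obtained from (31) by a bootstrap (`e^{−X}·(eˣe^{−X+δ}) = e^{−X+δ}`).

WHAT IS PROVED (ns `…Theorems.Prop7PinnedRegaugeChartBCH`; `SU(N)` for any nonempty `Fintype n`, any `P`, any level `k`).
* §1 matrix letters (`‖uZu* − Z‖ ≤ 2‖u − 1‖‖Z‖` is ✓ `Prop7CovariantCoercivity.norm_conj_sub_self_le'`, reused): ★ `norm_mlog_mul_exp_neg_mlog_add_sub_le` (the refined (31): `‖log(u·e^{−log u+δ}) − δ‖ ≤ 3‖log u‖‖δ‖` for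
  `‖u − 1‖ ≤ 1∕64`, `‖δ‖ ≤ 1∕16`), ★★ `norm_mlog_twist_sub_pureGauge_le_refined` (`‖log(u₋Wu₊*W*) − (μ₋ − Wμ₊W*)‖ ≤ 3‖μ₋‖·‖μ₋ − Wμ₊W*‖` for `‖u± − 1‖ ≤ 1∕64` — sharpens ✓ LEMMA (Ξ)
  `Prop7GaugeTwistLogRatio.norm_mlog_twist_sub_pureGauge_le` (`≤ 2‖μ₋‖‖μ₊‖`) when the covariant difference of `μ` is small), `norm_twist_sub_one_le`, `norm_sub_conj_le`, `norm_regauge_sub_one_le` (the SUP letter: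
  `‖u₋EWu₊*W* − 1‖ ≤ ‖E − 1‖ + ‖u₋ − Wu₊W*‖`), `regauge_eq_exp_mul_exp` (`u₋EWu₊*W* = e^{u₋(log E)u₋*}·e^{log(u₋Wu₊*W*)}`), and ★★★ `norm_mlog_regauge_sub_le` (the three-factor
  chart row displayed in the title).
* §2 bond letters (`X W : GaugeField`, `u : GaugeTransf`, `E = Y_b(W, X) + 1 = X_bW_b⁻¹`): `coe_pertVar_gaugeAct_add_one'` (the re-gauged ratio IS `u(b₋)·E·W_b·u(b₊)*·W_b*`),
  ★★ `norm_pertVar_gaugeAct_le` (chart SUP of `X^u`: `‖Y_b(W, X^u)‖ ≤ ‖Y_b(W, X)‖ + ‖u(b₋) − W_bu(b₊)W_b*‖`), ★★★ `norm_mlog_pertVar_gaugeAct_sub_le` (row (P-bch) per bond).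
HONEST SCOPE.  Pointwise matrix analysis only: the DIVERGENCE row of (P-bch) (`Σ_x‖D^*_W R₂‖² ≤ C′s_Q²(K + (C_blk+1)ℓ⁻²M)`, which needs bondwise DIFFERENCES of `R₂` and the flat
Weitzenböck identity) is NOT here; neither is the 𝔰𝔲∕Hermitian re-lettering `D = −i·log(·)` of the door (one `I•` away: ✓ `Prop7GaugeTwistLogRatio.su_pureGauge_mlog_transf`
gives the reality of the pure-gauge term).  Constants ours; nothing of the cited papers beyond (31) is asserted.

References: T. Bałaban, CMP 98 (1985) 17–51 [Balaban1985Averaging] ((8), (11) p.19, (21)–(23) p.21, (31) p.22); CMP 102 (1985) 277–309 [Balaban1985Variational] ((15) p.280,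
(141)–(143) p.299); CMP 99 (1985) 75–102 [Balaban1985RegularSpaces] ((1.14) p.78, (1.36) p.82).
-/

set_option autoImplicit false

noncomputable section

open scoped BigOperators Matrix.Norms.L2Operator
open NormedSpace

namespace Summit.QuantumFields.YangMills.Theorems.Prop7PinnedRegaugeChartBCH

open Literature.MathematicalPhysics.QuantumFieldTheory.Balaban1983to89
open BlockAveragingEMLLinearisedBackground (pertVar)
open MatrixLog (mlog exp_mlog norm_mlog_le_two_mul)
open B7BlockAvgLog (mlog_exp)
open B7Eq31BCH (eq31_of_sum_le exp_mul_exp_sub_one exp_one_fifth_le)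
open Summit.QuantumFields.YangMills.Theorems.Prop7HolRatioPerStep (coe_star_mul_self coe_mul_star_self norm_coe_eq_one norm_star_coe_eq_one)
open Summit.QuantumFields.YangMills.Theorems.Prop7CovIterLambdaBound (norm_conj_su_le)
open Summit.QuantumFields.YangMills.Theorems.Prop7GaugeTwistLogRatio (exp_conj_coe star_coe_eq_exp_neg_mlog)
open Summit.QuantumFields.YangMills.Theorems.Prop7CovariantCoercivity (norm_conj_sub_self_le')

variable {n : Type*} [Fintype n] [DecidableEq n] [Nonempty n]

/-! ## §1 Matrix letters -/

section MatrixLetters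

omit [Fintype n] [DecidableEq n] [Nonempty n] in
/-- numerics: `e^{3∕16} ≤ 11∕9` (from ✓ `B7Eq31BCH.exp_one_fifth_le`). [folklore] -/
theorem exp_three_sixteenths_le : Real.exp (3 / 16) ≤ 11 / 9 :=
  (Real.exp_le_exp.mpr (by norm_num)).trans exp_one_fifth_le

omit [Nonempty n] in
/-- ★ **THE REFINED (31).**  For `u ∈ SU(N)` with `‖u − 1‖ ≤ 1∕64`, `X := log u`, and `‖δ‖ ≤ 1∕16`: `‖log(u·e^{−X+δ}) − δ‖ ≤ 3‖X‖·‖δ‖` — the BCH remainder of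
`eˣe^{−X+δ}` vanishes at `δ = 0` (conjugation), so it is bilinear-small.  Proof: (31) once for the a-priori size of `ε′ := log(u·e^{−X+δ})`, then (31) for the pair
`(−X, ε′)` using `u*·(u·e^{−X+δ}) = e^{−X+δ}`, `u* = e^{−X}`, and absorption of `2‖X‖·‖ε′ − δ‖ ≤ ‖ε′ − δ‖∕16`. [cite: Balaban1985Averaging, (31) p.22, (21) p.21] -/
theorem norm_mlog_mul_exp_neg_mlog_add_sub_le (u : Matrix.specialUnitaryGroup n ℂ) (δ : Matrix n n ℂ)
    (hu : ‖(u : Matrix n n ℂ) - 1‖ ≤ 1 / 64) (hδ : ‖δ‖ ≤ 1 / 16) :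
    ‖mlog ((u : Matrix n n ℂ) * exp (-mlog (u : Matrix n n ℂ) + δ)) - δ‖ ≤ 3 * ‖mlog (u : Matrix n n ℂ)‖ * ‖δ‖ := by
  have hu1 : ‖(u : Matrix n n ℂ) - 1‖ < 1 := by linarith
  have hX : ‖mlog (u : Matrix n n ℂ)‖ ≤ 1 / 32 := (norm_mlog_le_two_mul (by linarith)).trans (by linarith)
  have hX0 : 0 ≤ ‖mlog (u : Matrix n n ℂ)‖ := norm_nonneg _
  have hδ0 : 0 ≤ ‖δ‖ := norm_nonneg δ
  have hY : ‖-mlog (u : Matrix n n ℂ) + δ‖ ≤ ‖mlog (u : Matrix n n ℂ)‖ + ‖δ‖ := by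
    calc ‖-mlog (u : Matrix n n ℂ) + δ‖ ≤ ‖-mlog (u : Matrix n n ℂ)‖ + ‖δ‖ := norm_add_le _ _
      _ = ‖mlog (u : Matrix n n ℂ)‖ + ‖δ‖ := by rw [norm_neg]
  -- `u = e^{log u}`
  have hueq : (u : Matrix n n ℂ) = exp (mlog (u : Matrix n n ℂ)) := (exp_mlog hu1).symm
  -- (1) a priori size of `ε′` by (31) for the pair `(X, −X+δ)`
  have h31a : ‖mlog (exp (mlog (u : Matrix n n ℂ)) * exp (-mlog (u : Matrix n n ℂ) + δ)) - mlog (u : Matrix n n ℂ) - (-mlog (u : Matrix n n ℂ) + δ)‖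
      ≤ 2 * ‖mlog (u : Matrix n n ℂ)‖ * ‖-mlog (u : Matrix n n ℂ) + δ‖ := eq31_of_sum_le (by linarith)
  rw [← hueq] at h31a
  have e1 : mlog ((u : Matrix n n ℂ) * exp (-mlog (u : Matrix n n ℂ) + δ)) - mlog (u : Matrix n n ℂ) - (-mlog (u : Matrix n n ℂ) + δ)
      = mlog ((u : Matrix n n ℂ) * exp (-mlog (u : Matrix n n ℂ) + δ)) - δ := by abel
  rw [e1] at h31a
  -- (2) `u·e^{−X+δ}` is in the domain of `log`, and `u*·(u·e^{−X+δ}) = e^{−X+δ}`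
  have hpY : ‖exp (-mlog (u : Matrix n n ℂ) + δ) - 1‖ ≤ 2 / 9 := by
    have h := Literature.Analysis.Calculus.norm_exp_sub_one_le (-mlog (u : Matrix n n ℂ) + δ)
    have h' : Real.exp ‖-mlog (u : Matrix n n ℂ) + δ‖ ≤ Real.exp (3 / 16) := Real.exp_le_exp.mpr (by linarith)
    linarith [exp_three_sixteenths_le]
  have hE : ‖(u : Matrix n n ℂ) * exp (-mlog (u : Matrix n n ℂ) + δ) - 1‖ < 1 := by
    have e : (u : Matrix n n ℂ) * exp (-mlog (u : Matrix n n ℂ) + δ) - 1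
        = ((u : Matrix n n ℂ) - 1) + (exp (-mlog (u : Matrix n n ℂ) + δ) - 1) + ((u : Matrix n n ℂ) - 1) * (exp (-mlog (u : Matrix n n ℂ) + δ) - 1) := by
      noncomm_ring
    rw [e]
    have h2 : ‖((u : Matrix n n ℂ) - 1) * (exp (-mlog (u : Matrix n n ℂ) + δ) - 1)‖ ≤ 1 / 64 * (2 / 9) :=
      (norm_mul_le _ _).trans (mul_le_mul hu hpY (norm_nonneg _) (by norm_num))
    have h3 := norm_add₃_le (a := (u : Matrix n n ℂ) - 1) (b := exp (-mlog (u : Matrix n n ℂ) + δ) - 1)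
      (c := ((u : Matrix n n ℂ) - 1) * (exp (-mlog (u : Matrix n n ℂ) + δ) - 1))
    linarith
  have hprod : exp (-mlog (u : Matrix n n ℂ)) * exp (mlog ((u : Matrix n n ℂ) * exp (-mlog (u : Matrix n n ℂ) + δ)))
      = exp (-mlog (u : Matrix n n ℂ) + δ) := by
    rw [exp_mlog hE, ← star_coe_eq_exp_neg_mlog u hu1, ← mul_assoc, coe_star_mul_self u, one_mul]
  have hlog2 : ‖-mlog (u : Matrix n n ℂ) + δ‖ < Real.log 2 := by
    have := Real.log_two_gt_d9
    linarith
  -- (3) (31) for the pair `(−X, ε′)`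
  have hε : ‖mlog ((u : Matrix n n ℂ) * exp (-mlog (u : Matrix n n ℂ) + δ))‖ ≤ ‖δ‖ + ‖mlog ((u : Matrix n n ℂ) * exp (-mlog (u : Matrix n n ℂ) + δ)) - δ‖ :=
    norm_le_insert' _ _
  have hsum : ‖-mlog (u : Matrix n n ℂ)‖ + ‖mlog ((u : Matrix n n ℂ) * exp (-mlog (u : Matrix n n ℂ) + δ))‖ ≤ 1 / 5 := by
    rw [norm_neg]; nlinarith
  have h31b := eq31_of_sum_le hsum
  rw [hprod, mlog_exp hlog2, norm_neg] at h31b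
  have e2 : -mlog (u : Matrix n n ℂ) + δ - -mlog (u : Matrix n n ℂ) - mlog ((u : Matrix n n ℂ) * exp (-mlog (u : Matrix n n ℂ) + δ))
      = -(mlog ((u : Matrix n n ℂ) * exp (-mlog (u : Matrix n n ℂ) + δ)) - δ) := by abel
  rw [e2, norm_neg] at h31b
  -- `t ≤ 2‖X‖(‖δ‖ + t)` with `2‖X‖ ≤ 1∕16` ⇒ `t ≤ 3‖X‖‖δ‖`
  have ht0 : 0 ≤ ‖mlog ((u : Matrix n n ℂ) * exp (-mlog (u : Matrix n n ℂ) + δ)) - δ‖ := norm_nonneg _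
  nlinarith

/-- ★★ **LEMMA (Ξ) REFINED — the twisted product against the COVARIANT DIFFERENCE of the gauge letter.**  For `u₋, u₊, W ∈ SU(N)` with `‖u± − 1‖ ≤ 1∕64` and
`μ± := log u±`: `‖log(u₋·W·u₊*·W*) − (μ₋ − W·μ₊·W*)‖ ≤ 3‖μ₋‖·‖μ₋ − W·μ₊·W*‖` (✓ `Prop7GaugeTwistLogRatio.norm_mlog_twist_sub_pureGauge_le` gives `2‖μ₋‖‖μ₊‖`;
here the bound is proportional to the covariant difference, which is what is `ℓ⁻¹`-small for a smooth gauge at scale ℓ).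
[cite: Balaban1985Averaging, (31) p.22, (8) p.19, (11) p.19] -/
theorem norm_mlog_twist_sub_pureGauge_le_refined (um up W : Matrix.specialUnitaryGroup n ℂ)
    (hm : ‖(um : Matrix n n ℂ) - 1‖ ≤ 1 / 64) (hp : ‖(up : Matrix n n ℂ) - 1‖ ≤ 1 / 64) :
    ‖mlog ((um : Matrix n n ℂ) * (W : Matrix n n ℂ) * star (up : Matrix n n ℂ) * star (W : Matrix n n ℂ))
        - (mlog (um : Matrix n n ℂ) - (W : Matrix n n ℂ) * mlog (up : Matrix n n ℂ) * star (W : Matrix n n ℂ))‖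
      ≤ 3 * ‖mlog (um : Matrix n n ℂ)‖
          * ‖mlog (um : Matrix n n ℂ) - (W : Matrix n n ℂ) * mlog (up : Matrix n n ℂ) * star (W : Matrix n n ℂ)‖ := by
  have hp1 : ‖(up : Matrix n n ℂ) - 1‖ < 1 := by linarith
  have hμm : ‖mlog (um : Matrix n n ℂ)‖ ≤ 1 / 32 := (norm_mlog_le_two_mul (by linarith)).trans (by linarith)
  have hμp : ‖mlog (up : Matrix n n ℂ)‖ ≤ 1 / 32 := (norm_mlog_le_two_mul (by linarith)).trans (by linarith)
  have hconj : ‖(W : Matrix n n ℂ) * mlog (up : Matrix n n ℂ) * star (W : Matrix n n ℂ)‖ ≤ 1 / 32 := (norm_conj_su_le W _).trans hμp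
  have hδle : ‖mlog (um : Matrix n n ℂ) - (W : Matrix n n ℂ) * mlog (up : Matrix n n ℂ) * star (W : Matrix n n ℂ)‖ ≤ 1 / 16 := by
    calc _ ≤ ‖mlog (um : Matrix n n ℂ)‖ + ‖(W : Matrix n n ℂ) * mlog (up : Matrix n n ℂ) * star (W : Matrix n n ℂ)‖ := norm_sub_le _ _
      _ ≤ 1 / 16 := by linarith
  -- the product is `u₋·e^{−log u₋ + δ}` with `δ = log u₋ − W log u₊ W*`
  have hprod : (um : Matrix n n ℂ) * (W : Matrix n n ℂ) * star (up : Matrix n n ℂ) * star (W : Matrix n n ℂ)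
      = (um : Matrix n n ℂ) * exp (-mlog (um : Matrix n n ℂ) + (mlog (um : Matrix n n ℂ) - (W : Matrix n n ℂ) * mlog (up : Matrix n n ℂ) * star (W : Matrix n n ℂ))) := by
    have e1 : -mlog (um : Matrix n n ℂ) + (mlog (um : Matrix n n ℂ) - (W : Matrix n n ℂ) * mlog (up : Matrix n n ℂ) * star (W : Matrix n n ℂ))
        = (W : Matrix n n ℂ) * (-mlog (up : Matrix n n ℂ)) * star (W : Matrix n n ℂ) := by
      rw [mul_neg, neg_mul]; abel
    rw [e1, exp_conj_coe W, ← star_coe_eq_exp_neg_mlog up hp1]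
    simp only [mul_assoc]
  rw [hprod]
  exact norm_mlog_mul_exp_neg_mlog_add_sub_le um _ hm hδle

/-- `‖u₋·W·u₊*·W* − 1‖ ≤ ‖u₋ − W·u₊·W*‖` (`G − 1 = (u₋ − Wu₊W*)·(Wu₊*W*)`, unitary factor). [folklore] -/
theorem norm_twist_sub_one_le (um up W : Matrix.specialUnitaryGroup n ℂ) :
    ‖(um : Matrix n n ℂ) * (W : Matrix n n ℂ) * star (up : Matrix n n ℂ) * star (W : Matrix n n ℂ) - 1‖
      ≤ ‖(um : Matrix n n ℂ) - (W : Matrix n n ℂ) * (up : Matrix n n ℂ) * star (W : Matrix n n ℂ)‖ := by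
  have hid : (W : Matrix n n ℂ) * (up : Matrix n n ℂ) * star (W : Matrix n n ℂ) * ((W : Matrix n n ℂ) * star (up : Matrix n n ℂ) * star (W : Matrix n n ℂ)) = 1 := by
    calc _ = (W : Matrix n n ℂ) * (up : Matrix n n ℂ) * (star (W : Matrix n n ℂ) * (W : Matrix n n ℂ)) * star (up : Matrix n n ℂ) * star (W : Matrix n n ℂ) := by
          noncomm_ring
      _ = 1 := by rw [coe_star_mul_self W, mul_one, mul_assoc (W : Matrix n n ℂ), coe_mul_star_self up, mul_one, coe_mul_star_self W]
  have e1 : (um : Matrix n n ℂ) * (W : Matrix n n ℂ) * star (up : Matrix n n ℂ) * star (W : Matrix n n ℂ) - 1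
      = ((um : Matrix n n ℂ) - (W : Matrix n n ℂ) * (up : Matrix n n ℂ) * star (W : Matrix n n ℂ))
          * ((W : Matrix n n ℂ) * star (up : Matrix n n ℂ) * star (W : Matrix n n ℂ)) := by
    rw [sub_mul, hid]; noncomm_ring
  have hV : ‖(W : Matrix n n ℂ) * star (up : Matrix n n ℂ) * star (W : Matrix n n ℂ)‖ ≤ 1 := by
    calc _ ≤ ‖(W : Matrix n n ℂ) * star (up : Matrix n n ℂ)‖ * ‖star (W : Matrix n n ℂ)‖ := norm_mul_le _ _
      _ ≤ (‖(W : Matrix n n ℂ)‖ * ‖star (up : Matrix n n ℂ)‖) * ‖star (W : Matrix n n ℂ)‖ := by gcongr; exact norm_mul_le _ _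
      _ = 1 := by rw [norm_coe_eq_one, norm_star_coe_eq_one, norm_star_coe_eq_one]; ring
  rw [e1]
  calc _ ≤ ‖(um : Matrix n n ℂ) - (W : Matrix n n ℂ) * (up : Matrix n n ℂ) * star (W : Matrix n n ℂ)‖
          * ‖(W : Matrix n n ℂ) * star (up : Matrix n n ℂ) * star (W : Matrix n n ℂ)‖ := norm_mul_le _ _
    _ ≤ ‖(um : Matrix n n ℂ) - (W : Matrix n n ℂ) * (up : Matrix n n ℂ) * star (W : Matrix n n ℂ)‖ * 1 := by gcongr
    _ = _ := mul_one _

/-- `‖u₋ − W·u₊·W*‖ ≤ ‖u₋ − 1‖ + ‖u₊ − 1‖`. [folklore] -/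
theorem norm_sub_conj_le (um up W : Matrix.specialUnitaryGroup n ℂ) :
    ‖(um : Matrix n n ℂ) - (W : Matrix n n ℂ) * (up : Matrix n n ℂ) * star (W : Matrix n n ℂ)‖ ≤ ‖(um : Matrix n n ℂ) - 1‖ + ‖(up : Matrix n n ℂ) - 1‖ := by
  have e : (um : Matrix n n ℂ) - (W : Matrix n n ℂ) * (up : Matrix n n ℂ) * star (W : Matrix n n ℂ)
      = ((um : Matrix n n ℂ) - 1) - (W : Matrix n n ℂ) * ((up : Matrix n n ℂ) - 1) * star (W : Matrix n n ℂ) := by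
    rw [mul_sub, sub_mul, mul_one, coe_mul_star_self W]; abel
  rw [e]
  calc _ ≤ ‖(um : Matrix n n ℂ) - 1‖ + ‖(W : Matrix n n ℂ) * ((up : Matrix n n ℂ) - 1) * star (W : Matrix n n ℂ)‖ := norm_sub_le _ _
    _ ≤ ‖(um : Matrix n n ℂ) - 1‖ + ‖(up : Matrix n n ℂ) - 1‖ := by gcongr; exact norm_conj_su_le W _

/-- **THE SUP LETTER.**  For `u₋, u₊, W ∈ SU(N)` and any `E`: `‖u₋·E·W·u₊*·W* − 1‖ ≤ ‖E − 1‖ + ‖u₋ − W·u₊·W*‖`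
(`u₋EWu₊*W* − 1 = u₋(E − 1)·(Wu₊*W*) + (u₋Wu₊*W* − 1)`, all factors unitary). [cite: Balaban1985Variational, (15) p.280, (141)-(143) p.299] -/
theorem norm_regauge_sub_one_le (um up W : Matrix.specialUnitaryGroup n ℂ) (E : Matrix n n ℂ) :
    ‖(um : Matrix n n ℂ) * E * (W : Matrix n n ℂ) * star (up : Matrix n n ℂ) * star (W : Matrix n n ℂ) - 1‖
      ≤ ‖E - 1‖ + ‖(um : Matrix n n ℂ) - (W : Matrix n n ℂ) * (up : Matrix n n ℂ) * star (W : Matrix n n ℂ)‖ := by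
  have e1 : (um : Matrix n n ℂ) * E * (W : Matrix n n ℂ) * star (up : Matrix n n ℂ) * star (W : Matrix n n ℂ) - 1
      = (um : Matrix n n ℂ) * (E - 1) * ((W : Matrix n n ℂ) * star (up : Matrix n n ℂ) * star (W : Matrix n n ℂ))
        + ((um : Matrix n n ℂ) * (W : Matrix n n ℂ) * star (up : Matrix n n ℂ) * star (W : Matrix n n ℂ) - 1) := by
    noncomm_ring
  have hV : ‖(W : Matrix n n ℂ) * star (up : Matrix n n ℂ) * star (W : Matrix n n ℂ)‖ ≤ 1 := by
    calc _ ≤ ‖(W : Matrix n n ℂ) * star (up : Matrix n n ℂ)‖ * ‖star (W : Matrix n n ℂ)‖ := norm_mul_le _ _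
      _ ≤ (‖(W : Matrix n n ℂ)‖ * ‖star (up : Matrix n n ℂ)‖) * ‖star (W : Matrix n n ℂ)‖ := by gcongr; exact norm_mul_le _ _
      _ = 1 := by rw [norm_coe_eq_one, norm_star_coe_eq_one, norm_star_coe_eq_one]; ring
  have h1 : ‖(um : Matrix n n ℂ) * (E - 1) * ((W : Matrix n n ℂ) * star (up : Matrix n n ℂ) * star (W : Matrix n n ℂ))‖ ≤ ‖E - 1‖ := by
    calc _ ≤ ‖(um : Matrix n n ℂ) * (E - 1)‖ * ‖(W : Matrix n n ℂ) * star (up : Matrix n n ℂ) * star (W : Matrix n n ℂ)‖ := norm_mul_le _ _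
      _ ≤ (‖(um : Matrix n n ℂ)‖ * ‖E - 1‖) * ‖(W : Matrix n n ℂ) * star (up : Matrix n n ℂ) * star (W : Matrix n n ℂ)‖ := by gcongr; exact norm_mul_le _ _
      _ ≤ (1 * ‖E - 1‖) * 1 := by
          gcongr
          · exact (norm_coe_eq_one um).le
      _ = ‖E - 1‖ := by ring
  rw [e1]
  exact (norm_add_le _ _).trans (add_le_add h1 (norm_twist_sub_one_le um up W))

/-- `u₋·E·W·u₊*·W* = e^{u₋(log E)u₋*}·e^{log(u₋Wu₊*W*)}` for `‖E − 1‖ < 1`, `‖u± − 1‖ ≤ 1∕64` (the factorisation `(u₋Eu₋*)·(u₋Wu₊*W*)` read through `exp ∘ log`).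
[cite: Balaban1985Averaging, (21) p.21, (8) p.19] -/
theorem regauge_eq_exp_mul_exp (um up W : Matrix.specialUnitaryGroup n ℂ) (E : Matrix n n ℂ)
    (hm : ‖(um : Matrix n n ℂ) - 1‖ ≤ 1 / 64) (hp : ‖(up : Matrix n n ℂ) - 1‖ ≤ 1 / 64) (hE : ‖E - 1‖ < 1) :
    (um : Matrix n n ℂ) * E * (W : Matrix n n ℂ) * star (up : Matrix n n ℂ) * star (W : Matrix n n ℂ)
      = exp ((um : Matrix n n ℂ) * mlog E * star (um : Matrix n n ℂ))
          * exp (mlog ((um : Matrix n n ℂ) * (W : Matrix n n ℂ) * star (up : Matrix n n ℂ) * star (W : Matrix n n ℂ))) := by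
  have hG1 : ‖(um : Matrix n n ℂ) * (W : Matrix n n ℂ) * star (up : Matrix n n ℂ) * star (W : Matrix n n ℂ) - 1‖ < 1 := by
    have h := (norm_twist_sub_one_le um up W).trans (norm_sub_conj_le um up W)
    linarith
  rw [exp_conj_coe um, exp_mlog hE, exp_mlog hG1]
  calc _ = (um : Matrix n n ℂ) * E * (star (um : Matrix n n ℂ) * (um : Matrix n n ℂ)) * (W : Matrix n n ℂ) * star (up : Matrix n n ℂ) * star (W : Matrix n n ℂ) := by
        rw [coe_star_mul_self um, mul_one]
    _ = _ := by noncomm_ring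

/-- ★★★ **THE CHART OF A RE-GAUGING TO FIRST ORDER (matrix form).**  For `u₋, u₊, W ∈ SU(N)` with `‖u± − 1‖ ≤ 1∕64`, `μ± := log u±`, and a ratio `E` with
`‖E − 1‖ ≤ 1∕64`: with `δ := μ₋ − W·μ₊·W*` (the covariant difference of the gauge letter),
`‖log(u₋·E·W·u₊*·W*) − (log E + δ)‖ ≤ 2‖u₋ − 1‖·‖log E‖ + 3‖μ₋‖·‖δ‖ + 4‖log E‖·‖δ‖`
(`u₋EWu₊*W* = e^{u₋(log E)u₋*}·e^{log G}`, `G = u₋Wu₊*W*`; (31) for that pair, ✓ `norm_conj_sub_self_le'` for `u₋(log E)u₋* − log E`, the refined (Ξ) for `log G − δ`).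
[cite: Balaban1985Averaging, (31) p.22, (8) p.19; Balaban1985Variational, (15) p.280, (141)-(143) p.299] -/
theorem norm_mlog_regauge_sub_le (um up W : Matrix.specialUnitaryGroup n ℂ) (E : Matrix n n ℂ)
    (hm : ‖(um : Matrix n n ℂ) - 1‖ ≤ 1 / 64) (hp : ‖(up : Matrix n n ℂ) - 1‖ ≤ 1 / 64) (hE : ‖E - 1‖ ≤ 1 / 64) :
    ‖mlog ((um : Matrix n n ℂ) * E * (W : Matrix n n ℂ) * star (up : Matrix n n ℂ) * star (W : Matrix n n ℂ))
        - (mlog E + (mlog (um : Matrix n n ℂ) - (W : Matrix n n ℂ) * mlog (up : Matrix n n ℂ) * star (W : Matrix n n ℂ)))‖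
      ≤ 2 * ‖(um : Matrix n n ℂ) - 1‖ * ‖mlog E‖
        + 3 * ‖mlog (um : Matrix n n ℂ)‖ * ‖mlog (um : Matrix n n ℂ) - (W : Matrix n n ℂ) * mlog (up : Matrix n n ℂ) * star (W : Matrix n n ℂ)‖
        + 4 * ‖mlog E‖ * ‖mlog (um : Matrix n n ℂ) - (W : Matrix n n ℂ) * mlog (up : Matrix n n ℂ) * star (W : Matrix n n ℂ)‖ := by
  have hE1 : ‖E - 1‖ < 1 := by linarith
  have hlogE : ‖mlog E‖ ≤ 1 / 32 := (norm_mlog_le_two_mul (by linarith)).trans (by linarith)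
  have hE0 : 0 ≤ ‖mlog E‖ := norm_nonneg _
  -- size of `G − 1` and of `log G`
  have hG1 : ‖(um : Matrix n n ℂ) * (W : Matrix n n ℂ) * star (up : Matrix n n ℂ) * star (W : Matrix n n ℂ) - 1‖ ≤ 1 / 32 := by
    have h := (norm_twist_sub_one_le um up W).trans (norm_sub_conj_le um up W)
    linarith
  have hlogG : ‖mlog ((um : Matrix n n ℂ) * (W : Matrix n n ℂ) * star (up : Matrix n n ℂ) * star (W : Matrix n n ℂ))‖ ≤ 1 / 16 :=
    (norm_mlog_le_two_mul (by linarith)).trans (by linarith)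
  -- the refined (Ξ)
  have hΞ := norm_mlog_twist_sub_pureGauge_le_refined um up W hm hp
  have hμm : ‖mlog (um : Matrix n n ℂ)‖ ≤ 1 / 32 := (norm_mlog_le_two_mul (by linarith)).trans (by linarith)
  have hδ0 : 0 ≤ ‖mlog (um : Matrix n n ℂ) - (W : Matrix n n ℂ) * mlog (up : Matrix n n ℂ) * star (W : Matrix n n ℂ)‖ := norm_nonneg _
  have hlogGδ : ‖mlog ((um : Matrix n n ℂ) * (W : Matrix n n ℂ) * star (up : Matrix n n ℂ) * star (W : Matrix n n ℂ))‖
      ≤ 2 * ‖mlog (um : Matrix n n ℂ) - (W : Matrix n n ℂ) * mlog (up : Matrix n n ℂ) * star (W : Matrix n n ℂ)‖ := by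
    have h1 := norm_le_insert' (mlog ((um : Matrix n n ℂ) * (W : Matrix n n ℂ) * star (up : Matrix n n ℂ) * star (W : Matrix n n ℂ)))
      (mlog (um : Matrix n n ℂ) - (W : Matrix n n ℂ) * mlog (up : Matrix n n ℂ) * star (W : Matrix n n ℂ))
    nlinarith
  -- (31) for the pair `(u₋(log E)u₋*, log G)`
  have hA : ‖(um : Matrix n n ℂ) * mlog E * star (um : Matrix n n ℂ)‖ ≤ ‖mlog E‖ := norm_conj_su_le um _
  have hsum : ‖(um : Matrix n n ℂ) * mlog E * star (um : Matrix n n ℂ)‖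
      + ‖mlog ((um : Matrix n n ℂ) * (W : Matrix n n ℂ) * star (up : Matrix n n ℂ) * star (W : Matrix n n ℂ))‖ ≤ 1 / 5 := by linarith
  have h31 := eq31_of_sum_le hsum
  have hconj := norm_conj_sub_self_le' um (mlog E)
  -- assemble
  have e : mlog ((um : Matrix n n ℂ) * E * (W : Matrix n n ℂ) * star (up : Matrix n n ℂ) * star (W : Matrix n n ℂ))
        - (mlog E + (mlog (um : Matrix n n ℂ) - (W : Matrix n n ℂ) * mlog (up : Matrix n n ℂ) * star (W : Matrix n n ℂ)))
      = (mlog (exp ((um : Matrix n n ℂ) * mlog E * star (um : Matrix n n ℂ))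
            * exp (mlog ((um : Matrix n n ℂ) * (W : Matrix n n ℂ) * star (up : Matrix n n ℂ) * star (W : Matrix n n ℂ))))
          - (um : Matrix n n ℂ) * mlog E * star (um : Matrix n n ℂ)
          - mlog ((um : Matrix n n ℂ) * (W : Matrix n n ℂ) * star (up : Matrix n n ℂ) * star (W : Matrix n n ℂ)))
        + ((um : Matrix n n ℂ) * mlog E * star (um : Matrix n n ℂ) - mlog E)
        + (mlog ((um : Matrix n n ℂ) * (W : Matrix n n ℂ) * star (up : Matrix n n ℂ) * star (W : Matrix n n ℂ))
            - (mlog (um : Matrix n n ℂ) - (W : Matrix n n ℂ) * mlog (up : Matrix n n ℂ) * star (W : Matrix n n ℂ))) := by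
    rw [regauge_eq_exp_mul_exp um up W E hm hp hE1]; abel
  rw [e]
  refine (norm_add₃_le).trans ?_
  refine (add_le_add (add_le_add h31 hconj) hΞ).trans ?_
  nlinarith [mul_le_mul hA hlogGδ (norm_nonneg _) hE0]

end MatrixLetters

/-! ## §2 Bond letters: the chart of the re-gauged configuration `X^u` against the background `W` -/

section BondLetters

variable {P : Params} {k : ℕ}

/-- **THE RE-GAUGED RATIO**: `Y_b(W, X^u) + 1 = (X^u)_b·W_b⁻¹ = u(b₋)·(Y_b(W, X) + 1)·W_b·u(b₊)*·W_b*` read in `M_N(ℂ)` (`(X^u)_b = u(b₋)X_bu(b₊)⁻¹`,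
`X_b = (X_bW_b*)·W_b`). [cite: Balaban1985Averaging, (8) p.19; Balaban1985Variational, (15) p.280] -/
theorem coe_pertVar_gaugeAct_add_one' (W X : GaugeField P k (Matrix.specialUnitaryGroup n ℂ)) (u : GaugeTransf P k (Matrix.specialUnitaryGroup n ℂ)) (b : PBond P k) :
    pertVar W (GaugeField.gaugeAct u X) b + 1
      = ((u b.src : Matrix.specialUnitaryGroup n ℂ) : Matrix n n ℂ) * (pertVar W X b + 1) * ((W b : Matrix.specialUnitaryGroup n ℂ) : Matrix n n ℂ)
          * star ((u b.tgt : Matrix.specialUnitaryGroup n ℂ) : Matrix n n ℂ) * star ((W b : Matrix.specialUnitaryGroup n ℂ) : Matrix n n ℂ) := by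
  have h1 : pertVar W X b + 1 = ((X b : Matrix.specialUnitaryGroup n ℂ) : Matrix n n ℂ) * star ((W b : Matrix.specialUnitaryGroup n ℂ) : Matrix n n ℂ) := by
    rw [pertVar, sub_add_cancel]; rfl
  have h2 : pertVar W (GaugeField.gaugeAct u X) b + 1
      = ((u b.src : Matrix.specialUnitaryGroup n ℂ) : Matrix n n ℂ) * ((X b : Matrix.specialUnitaryGroup n ℂ) : Matrix n n ℂ)
          * star ((u b.tgt : Matrix.specialUnitaryGroup n ℂ) : Matrix n n ℂ) * star ((W b : Matrix.specialUnitaryGroup n ℂ) : Matrix n n ℂ) := by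
    rw [pertVar, sub_add_cancel]; rfl
  rw [h2, h1]
  calc _ = ((u b.src : Matrix.specialUnitaryGroup n ℂ) : Matrix n n ℂ) * ((X b : Matrix.specialUnitaryGroup n ℂ) : Matrix n n ℂ)
          * (star ((W b : Matrix.specialUnitaryGroup n ℂ) : Matrix n n ℂ) * ((W b : Matrix.specialUnitaryGroup n ℂ) : Matrix n n ℂ))
          * star ((u b.tgt : Matrix.specialUnitaryGroup n ℂ) : Matrix n n ℂ) * star ((W b : Matrix.specialUnitaryGroup n ℂ) : Matrix n n ℂ) := by
        rw [coe_star_mul_self (W b), mul_one]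
    _ = _ := by noncomm_ring

/-- ★★ **CHART SUP OF THE RE-GAUGED COMPETITOR.**  `‖Y_b(W, X^u)‖ ≤ ‖Y_b(W, X)‖ + ‖u(b₋) − W_b·u(b₊)·W_b*‖` — the chart sup of `X^u` against `W` is that of `X` plus
the covariant difference of the GROUP-valued gauge `u` across the bond (for a pinned corrector smooth at scale ℓ this is the `ℓ⁻¹`-small letter, not `‖u − 1‖`).
[cite: Balaban1985Variational, (15) p.280, (141)-(143) p.299] -/
theorem norm_pertVar_gaugeAct_le (W X : GaugeField P k (Matrix.specialUnitaryGroup n ℂ)) (u : GaugeTransf P k (Matrix.specialUnitaryGroup n ℂ)) (b : PBond P k) :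
    ‖pertVar W (GaugeField.gaugeAct u X) b‖
      ≤ ‖pertVar W X b‖ + ‖((u b.src : Matrix.specialUnitaryGroup n ℂ) : Matrix n n ℂ)
          - ((W b : Matrix.specialUnitaryGroup n ℂ) : Matrix n n ℂ) * ((u b.tgt : Matrix.specialUnitaryGroup n ℂ) : Matrix n n ℂ) * star ((W b : Matrix.specialUnitaryGroup n ℂ) : Matrix n n ℂ)‖ := by
  have h := norm_regauge_sub_one_le (u b.src) (u b.tgt) (W b) (pertVar W X b + 1)
  rw [add_sub_cancel_right, ← coe_pertVar_gaugeAct_add_one' W X u b, add_sub_cancel_right] at h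
  exact h

/-- ★★★ **ROW (P-bch), ONE BOND — the chart of a (pinned) re-gauging to first order.**  For `SU(N)` fields `W` (background), `X` (a competitor already in some gauge,
with `‖Y_b(W,X)‖ ≤ 1∕64`), and a gauge transformation `u` with `‖u(b±) − 1‖ ≤ 1∕64`, `μ := log ∘ u`, `δ_b := μ(b₋) − W_bμ(b₊)W_b*`:
`‖log(Y_b(W, X^u) + 1) − (log(Y_b(W, X) + 1) + δ_b)‖ ≤ 2‖u(b₋) − 1‖·‖log(Y_b(W,X)+1)‖ + 3‖μ(b₋)‖·‖δ_b‖ + 4‖log(Y_b(W,X)+1)‖·‖δ_b‖`.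
In the door's currency (✓ `Prop7LocMinOfPinnedChartSlice.stub_PV3E_of_pinnedChartSliceM`: `D = −i·log(Y + 1)`, `‖D‴‖ ≤ s‴ℓ⁻¹`, `‖δ‖ ≲ s_Qℓ⁻¹`, `‖u − 1‖, ‖μ‖ ≲ s_Q`) the
right side is `O(s_Q(s‴ + s_Q))·ℓ⁻¹`. [cite: Balaban1985Averaging, (31) p.22, (8) p.19, (11) p.19; Balaban1985Variational, (15) p.280, (141)-(143) p.299] -/
theorem norm_mlog_pertVar_gaugeAct_sub_le (W X : GaugeField P k (Matrix.specialUnitaryGroup n ℂ)) (u : GaugeTransf P k (Matrix.specialUnitaryGroup n ℂ)) (b : PBond P k)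
    (hs : ‖((u b.src : Matrix.specialUnitaryGroup n ℂ) : Matrix n n ℂ) - 1‖ ≤ 1 / 64) (ht : ‖((u b.tgt : Matrix.specialUnitaryGroup n ℂ) : Matrix n n ℂ) - 1‖ ≤ 1 / 64)
    (hY : ‖pertVar W X b‖ ≤ 1 / 64) :
    ‖mlog (pertVar W (GaugeField.gaugeAct u X) b + 1)
        - (mlog (pertVar W X b + 1)
            + (mlog ((u b.src : Matrix.specialUnitaryGroup n ℂ) : Matrix n n ℂ)
                - ((W b : Matrix.specialUnitaryGroup n ℂ) : Matrix n n ℂ) * mlog ((u b.tgt : Matrix.specialUnitaryGroup n ℂ) : Matrix n n ℂ)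
                    * star ((W b : Matrix.specialUnitaryGroup n ℂ) : Matrix n n ℂ)))‖
      ≤ 2 * ‖((u b.src : Matrix.specialUnitaryGroup n ℂ) : Matrix n n ℂ) - 1‖ * ‖mlog (pertVar W X b + 1)‖
        + 3 * ‖mlog ((u b.src : Matrix.specialUnitaryGroup n ℂ) : Matrix n n ℂ)‖
            * ‖mlog ((u b.src : Matrix.specialUnitaryGroup n ℂ) : Matrix n n ℂ)
                - ((W b : Matrix.specialUnitaryGroup n ℂ) : Matrix n n ℂ) * mlog ((u b.tgt : Matrix.specialUnitaryGroup n ℂ) : Matrix n n ℂ)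
                    * star ((W b : Matrix.specialUnitaryGroup n ℂ) : Matrix n n ℂ)‖
        + 4 * ‖mlog (pertVar W X b + 1)‖
            * ‖mlog ((u b.src : Matrix.specialUnitaryGroup n ℂ) : Matrix n n ℂ)
                - ((W b : Matrix.specialUnitaryGroup n ℂ) : Matrix n n ℂ) * mlog ((u b.tgt : Matrix.specialUnitaryGroup n ℂ) : Matrix n n ℂ)
                    * star ((W b : Matrix.specialUnitaryGroup n ℂ) : Matrix n n ℂ)‖ := by
  rw [coe_pertVar_gaugeAct_add_one']
  have hE : ‖(pertVar W X b + 1) - 1‖ ≤ 1 / 64 := by rw [add_sub_cancel_right]; exact hY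
  exact norm_mlog_regauge_sub_le (u b.src) (u b.tgt) (W b) (pertVar W X b + 1) hs ht hE

end BondLetters

end Summit.QuantumFields.YangMills.Theorems.Prop7PinnedRegaugeChartBCH

end
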